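import Literature.AlgebraicGeometry.GroupSchemes.CartierDualBaseChangeNatural
import Literature.AlgebraicGeometry.GroupSchemes.CartierDualAnnihilator
import Literature.AlgebraicGeometry.GroupSchemes.GroupSchemeKernelBaseChange
import HarnessLib

/-!
# The annihilator commutes with base change: `(H^⊥)_{R′} ≅ (H_{R′})^⊥` (Tate 1997 §(3.8); Görtz–Wedhorn I (4.15), Def. 4.45)

Layer `Literature/AlgebraicGeometry/GroupSchemes`, namespaces `Literature.AlgebraicGeometry.GroupSchemes.GroupSchemeKernel` (§0, generic) and
`Literature.AlgebraicGeometry.GroupSchemes.AffineGroupScheme` (§1–§2) (continues ★ `CartierDualAnnihilator` p845459 — `annihilator j = H^⊥ :=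
ker (j^D)`, `annihilatorι` —, ★ `CartierDualBaseChangeNatural` p846161 — the PINNED base-change isomorphism `cartierDualBaseChangeIso R′ G :
(G^D)_{R′} ≅ (G_{R′})^D` and its naturality square `pullback_map_cartierDualMap_comp_cartierDualBaseChangeIso_hom` — and ★
`GroupSchemeKernelBaseChange` — `GroupSchemeKernel.baseChangeIso : (Ker f)_{S′} ≅ Ker (f_{S′})`).  Two `def`s with bodies (`kerIsoOfSq`, a
pinned kernel transport along a square with isomorphism sides, and `annihilatorBaseChangeIso`) + theorems; no instance, no notation, no named
fact, no `sorry`.  Cell `hodgecm-mathlib` (D-0151), programme P6 «MOD», organ (N2b) of B-p04 (g38): the clause «`(·)^⊥` commutes with base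
change `Ω ← 𝒪_Ω → κ̄`» of the ST-0 «ANNIHILATOR» census (A-p17 (g24)), the last open line of the (g1)∕(g3) Cartier-duality bookkeeping.
Count-neutral Mathlib-side capital: HC_CM is proved only modulo the printed citations until rung 0 closes; nothing here bears on it.

THE PRINT ([Tate1997FiniteFlatGroupSchemes] §(3.8) pp. 145–146: «`(A_B)′ = A′_B`» functorially in `A`, and Cartier duality is exact, so
`(G⧸H)^D = ker (G^D → H^D)` is formed compatibly with base change; [GortzWedhorn2020] (4.15): fibre products — hence kernels, Def. 4.45 (2) —
commute with base change).  For finite free commutative affine group objects `H`, `G` of `SchemeOver R`, a homomorphism `j : H ⟶ G`, a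
commutative `R`-algebra `R′` and `X_{R′} := (Over.pullback (Spec R′ → Spec R)).obj X` (Mathlib's transported group object):

* §0 GENERIC (any cartesian monoidal category): **`kerIsoOfSq φ φ′ e_G e_H h : Ker φ ≅ Ker φ′`** for a square `φ ≫ e_H.hom = e_G.hom ≫ φ′` whose
  sides `e_G : G ≅ G′`, `e_H : H ≅ H′` are isomorphisms (`e_H.hom` a homomorphism) — PINNED: `hom ≫ ι′ = ι ≫ e_G.hom`, `inv ≫ ι = ι′ ≫ e_G.inv`
  (★ `kerLift`); a homomorphism of group objects when `φ`, `φ′`, `e_G.hom` are (★ `isMonHom_kerLift`).  (The `∃`-form is ★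
  `AbelianVariety.exists_kerIso_of_sq` in `AbelianSchemes/AbelianSchemeFibreKernelTransport`; ★ `RelFrobenius.kerCompIso` is the case `e_G = 1`.)
* §1 **`annihilatorBaseChangeIso R′ j : (H^⊥)_{R′} ≅ (H_{R′})^⊥`** := ★ `baseChangeIso` (`(ker j^D)_{R′} ≅ ker ((j^D)_{R′})`) followed by
  `kerIsoOfSq` along the natural square `(j^D)_{R′} ≫ φ_H = φ_G ≫ (j_{R′})^D` of ★ `CartierDualBaseChangeNatural`; COMPATIBLE WITH THE
  INCLUSIONS: **`annihilatorBaseChangeIso_hom_comp_annihilatorι : hom ≫ ι_{H_{R′}} = (ι_H)_{R′} ≫ φ_G.hom`** (and the `inv` form), and an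
  isomorphism of GROUP schemes over `R′` (`isMonHom_annihilatorBaseChangeIso_hom ∕ _inv`).
* §2 POINTS: a `T`-point of `(G^D)_{R′}` factors through `(H^⊥)_{R′}` iff its image under `φ_G` factors through `(H_{R′})^⊥`
  (`exists_eq_comp_pullback_map_annihilatorι_iff`).

## References
* [Tate1997FiniteFlatGroupSchemes] J. Tate, *Finite flat group schemes*, in: Modular Forms and Fermat's Last Theorem (1997), §(3.8) pp. 145–146.
* [GortzWedhorn2020] U. Görtz, T. Wedhorn, *Algebraic Geometry I: Schemes*, 2nd ed. (2020), (4.15) p. 116 and Definition 4.45 (2), p. 117.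
-/

set_option autoImplicit false

-- Mathlib's `Over`/`Scheme` APIs are stated across semireducible wrappers (as in the ★ `GroupSchemes/*` files).
set_option backward.isDefEq.respectTransparency false

universe v₁ u₁ u

open CategoryTheory CategoryTheory.Limits AlgebraicGeometry MonoidalCategory CartesianMonoidalCategory TensorProduct WithConv

noncomputable section

namespace Literature.AlgebraicGeometry.GroupSchemes

/-! ## §0 Generic: the kernel is transported along a square with isomorphism sides -/

namespace GroupSchemeKernel

open scoped MonObj

section Square

variable {C : Type u₁} [Category.{v₁} C] [CartesianMonoidalCategory C] {G H G' H' : C} [GrpObj H] [GrpObj H']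
  (φ : G ⟶ H) (φ' : G' ⟶ H') (eG : G ≅ G') (eH : H ≅ H') [IsMonHom eH.hom] (h : φ ≫ eH.hom = eG.hom ≫ φ')
  [HasPullback φ η[H]] [HasPullback φ' η[H']]

omit [HasPullback φ' η[H']] in
include h in
/-- `Ker φ → G ≅ G′ → H′` is trivial (the square and `ι ≫ φ = 1`). [cite: GortzWedhorn2020, Definition 4.45 (2), p. 117] -/
theorem kerι_comp_hom_comp_eq_one : (kerι φ ≫ eG.hom) ≫ φ' = 1 := by
  rw [Category.assoc, ← h, ← Category.assoc, kerι_comp, MonObj.one_comp]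

omit [HasPullback φ η[H]] in
include h in
/-- `Ker φ′ → G′ ≅ G → H` is trivial (the inverse square `φ′ ≫ e_H⁻¹ = e_G⁻¹ ≫ φ`; `e_H⁻¹` preserves `1` because `e_H` does).
[cite: GortzWedhorn2020, Definition 4.45 (2), p. 117] -/
theorem kerι_comp_inv_comp_eq_one : (kerι φ' ≫ eG.inv) ≫ φ = 1 := by
  have hinv : φ' ≫ eH.inv = eG.inv ≫ φ := by
    rw [Iso.comp_inv_eq, Category.assoc, h, Iso.inv_hom_id_assoc]
  have hone : (1 : ker φ' ⟶ H') ≫ eH.inv = 1 := by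
    rw [← MonObj.one_comp eH.hom, Category.assoc, Iso.hom_inv_id, Category.comp_id]
  rw [Category.assoc, ← hinv, ← Category.assoc, kerι_comp, hone]

/-- **Kernel transport along a square with isomorphism sides**: for `φ ≫ e_H.hom = e_G.hom ≫ φ′` with `e_G : G ≅ G′`, `e_H : H ≅ H′`
isomorphisms (`e_H.hom` a homomorphism of group objects), **`Ker φ ≅ Ker φ′`**, PINNED by `hom ≫ ι′ = ι ≫ e_G.hom` and `inv ≫ ι = ι′ ≫ e_G.inv`
(both maps are ★ `kerLift`s).  [cite: GortzWedhorn2020, Definition 4.45 (2), p. 117] -/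
def kerIsoOfSq : ker φ ≅ ker φ' where
  hom := kerLift (kerι φ ≫ eG.hom) (kerι_comp_hom_comp_eq_one φ φ' eG eH h)
  inv := kerLift (kerι φ' ≫ eG.inv) (kerι_comp_inv_comp_eq_one φ φ' eG eH h)
  hom_inv_id := ker_hom_ext (by
    rw [Category.assoc, kerLift_ι, ← Category.assoc, kerLift_ι, Category.assoc, Iso.hom_inv_id, Category.comp_id, Category.id_comp])
  inv_hom_id := ker_hom_ext (by
    rw [Category.assoc, kerLift_ι, ← Category.assoc, kerLift_ι, Category.assoc, Iso.inv_hom_id, Category.comp_id, Category.id_comp])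

/-- `kerIsoOfSq.hom ≫ ι′ = ι ≫ e_G.hom`. [cite: GortzWedhorn2020, Definition 4.45 (2), p. 117] -/
@[reassoc]
theorem kerIsoOfSq_hom_comp_kerι : (kerIsoOfSq φ φ' eG eH h).hom ≫ kerι φ' = kerι φ ≫ eG.hom :=
  kerLift_ι _ (kerι_comp_hom_comp_eq_one φ φ' eG eH h)

/-- `kerIsoOfSq.inv ≫ ι = ι′ ≫ e_G.inv`. [cite: GortzWedhorn2020, Definition 4.45 (2), p. 117] -/
@[reassoc]
theorem kerIsoOfSq_inv_comp_kerι : (kerIsoOfSq φ φ' eG eH h).inv ≫ kerι φ = kerι φ' ≫ eG.inv :=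
  kerLift_ι _ (kerι_comp_inv_comp_eq_one φ φ' eG eH h)

variable [GrpObj G] [GrpObj G'] [IsMonHom φ] [IsMonHom φ'] [IsMonHom eG.hom]

/-- **`kerIsoOfSq.hom` is a homomorphism of group objects** when `φ`, `φ′` and `e_G.hom` are (★ `isMonHom_kerLift`, ★ `isMonHom_kerι`).
[cite: GortzWedhorn2020, Definition 4.45 (2), p. 117] -/
theorem isMonHom_kerIsoOfSq_hom : IsMonHom (kerIsoOfSq φ φ' eG eH h).hom :=
  isMonHom_kerLift (kerι φ ≫ eG.hom) (kerι_comp_hom_comp_eq_one φ φ' eG eH h)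

/-- **`kerIsoOfSq.inv` is a homomorphism of group objects** (`e_G⁻¹` is one, Mathlib). [cite: GortzWedhorn2020, Definition 4.45 (2), p. 117] -/
theorem isMonHom_kerIsoOfSq_inv : IsMonHom (kerIsoOfSq φ φ' eG eH h).inv :=
  isMonHom_kerLift (kerι φ' ≫ eG.inv) (kerι_comp_inv_comp_eq_one φ φ' eG eH h)

end Square

end GroupSchemeKernel

/-! ## §1 `(H^⊥)_{R′} ≅ (H_{R′})^⊥` -/

namespace AffineGroupScheme

open scoped MonObj CategoryTheory.Obj

open Literature.AlgebraicGeometry.Motives Literature.NumberTheory.DiophantineGeometry Literature.RingTheory.HopfAlgebra GroupSchemeKernel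

variable {R : Type u} [CommRing R] (R' : Type u) [CommRing R'] [Algebra R R'] {H G : SchemeOver R}
  [GrpObj H] [IsCommMonObj H] [IsAffine H.left] [Module.Free R (Alg H)] [Module.Finite R (Alg H)]
  [IsAffine ((Over.pullback (Spec.map (CommRingCat.ofHom (algebraMap R R')))).obj H).left]
  [IsCommMonObj ((Over.pullback (Spec.map (CommRingCat.ofHom (algebraMap R R')))).obj H)]
  [Module.Free R' (Alg ((Over.pullback (Spec.map (CommRingCat.ofHom (algebraMap R R')))).obj H))]
  [Module.Finite R' (Alg ((Over.pullback (Spec.map (CommRingCat.ofHom (algebraMap R R')))).obj H))]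
  [IsAffine ((Over.pullback (Spec.map (CommRingCat.ofHom (algebraMap R R')))).obj (cartierDual H)).left]
  [GrpObj G] [IsCommMonObj G] [IsAffine G.left] [Module.Free R (Alg G)] [Module.Finite R (Alg G)]
  [IsAffine ((Over.pullback (Spec.map (CommRingCat.ofHom (algebraMap R R')))).obj G).left]
  [IsCommMonObj ((Over.pullback (Spec.map (CommRingCat.ofHom (algebraMap R R')))).obj G)]
  [Module.Free R' (Alg ((Over.pullback (Spec.map (CommRingCat.ofHom (algebraMap R R')))).obj G))]
  [Module.Finite R' (Alg ((Over.pullback (Spec.map (CommRingCat.ofHom (algebraMap R R')))).obj G))]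
  [IsAffine ((Over.pullback (Spec.map (CommRingCat.ofHom (algebraMap R R')))).obj (cartierDual G)).left]
  (j : H ⟶ G) [IsMonHom j]

/-- **THE ANNIHILATOR COMMUTES WITH BASE CHANGE: `(H^⊥)_{R′} ≅ (H_{R′})^⊥`** — `(ker j^D)_{R′} ≅ ker ((j^D)_{R′})` (★ `GroupSchemeKernel.baseChangeIso`:
kernels commute with base change) `≅ ker ((j_{R′})^D) = (H_{R′})^⊥` (§0 `kerIsoOfSq` along the natural square `(j^D)_{R′} ≫ φ_H = φ_G ≫ (j_{R′})^D`
of ★ `pullback_map_cartierDualMap_comp_cartierDualBaseChangeIso_hom`, `φ = cartierDualBaseChangeIso`).  [cite: Tate1997FiniteFlatGroupSchemes, §(3.8) pp. 145–146] -/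
def annihilatorBaseChangeIso :
    (Over.pullback (Spec.map (CommRingCat.ofHom (algebraMap R R')))).obj (annihilator j) ≅
      annihilator ((Over.pullback (Spec.map (CommRingCat.ofHom (algebraMap R R')))).map j) :=
  haveI := isMonHom_cartierDualBaseChangeIso_hom R' H
  baseChangeIso (Spec.map (CommRingCat.ofHom (algebraMap R R'))) (cartierDualMap j) ≪≫
    kerIsoOfSq ((Over.pullback (Spec.map (CommRingCat.ofHom (algebraMap R R')))).map (cartierDualMap j))
      (cartierDualMap ((Over.pullback (Spec.map (CommRingCat.ofHom (algebraMap R R')))).map j))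
      (cartierDualBaseChangeIso R' G) (cartierDualBaseChangeIso R' H)
      (pullback_map_cartierDualMap_comp_cartierDualBaseChangeIso_hom R' j)

/-- **Compatibility with the inclusions: `hom ≫ ι_{H_{R′}} = (ι_H)_{R′} ≫ φ_G.hom`** — under `(H^⊥)_{R′} ≅ (H_{R′})^⊥` and `φ_G : (G^D)_{R′} ≅ (G_{R′})^D`
the base-changed inclusion `(H^⊥ → G^D)_{R′}` IS the inclusion `(H_{R′})^⊥ → (G_{R′})^D` (★ `baseChangeIso_hom_comp_kerι`, §0 `kerIsoOfSq_hom_comp_kerι`).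
[cite: Tate1997FiniteFlatGroupSchemes, §(3.8) pp. 145–146] -/
theorem annihilatorBaseChangeIso_hom_comp_annihilatorι :
    (annihilatorBaseChangeIso R' j).hom ≫ annihilatorι ((Over.pullback (Spec.map (CommRingCat.ofHom (algebraMap R R')))).map j) =
      (Over.pullback (Spec.map (CommRingCat.ofHom (algebraMap R R')))).map (annihilatorι j) ≫ (cartierDualBaseChangeIso R' G).hom := by
  haveI := isMonHom_cartierDualBaseChangeIso_hom R' H
  change ((baseChangeIso (Spec.map (CommRingCat.ofHom (algebraMap R R'))) (cartierDualMap j)).hom ≫ (kerIsoOfSq _ _ _ _ _).hom) ≫ kerι _ =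
    (Over.pullback (Spec.map (CommRingCat.ofHom (algebraMap R R')))).map (kerι (cartierDualMap j)) ≫ _
  rw [Category.assoc, kerIsoOfSq_hom_comp_kerι, ← Category.assoc, baseChangeIso_hom_comp_kerι]

/-- **The inverse form: `inv ≫ (ι_H)_{R′} = ι_{H_{R′}} ≫ φ_G.inv`.** [cite: Tate1997FiniteFlatGroupSchemes, §(3.8) pp. 145–146] -/
theorem annihilatorBaseChangeIso_inv_comp_pullback_map_annihilatorι :
    (annihilatorBaseChangeIso R' j).inv ≫ (Over.pullback (Spec.map (CommRingCat.ofHom (algebraMap R R')))).map (annihilatorι j) =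
      annihilatorι ((Over.pullback (Spec.map (CommRingCat.ofHom (algebraMap R R')))).map j) ≫ (cartierDualBaseChangeIso R' G).inv := by
  rw [Iso.inv_comp_eq, ← Category.assoc, annihilatorBaseChangeIso_hom_comp_annihilatorι, Category.assoc, Iso.hom_inv_id, Category.comp_id]

/-- **`(H^⊥)_{R′} ≅ (H_{R′})^⊥` is an isomorphism of GROUP schemes over `R′`** (★ `isMonHom_baseChangeIso_hom`, §0 `isMonHom_kerIsoOfSq_hom`, ★
`isMonHom_cartierDualBaseChangeIso_hom`; the base-changed `(j^D)_{R′}` is a homomorphism of the transported group objects, Mathlib).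
[cite: Tate1997FiniteFlatGroupSchemes, §(3.8) pp. 145–146] -/
theorem isMonHom_annihilatorBaseChangeIso_hom : IsMonHom (annihilatorBaseChangeIso R' j).hom := by
  haveI := isMonHom_cartierDualBaseChangeIso_hom R' H
  haveI := isMonHom_cartierDualBaseChangeIso_hom R' G
  haveI h1 : IsMonHom (baseChangeIso (Spec.map (CommRingCat.ofHom (algebraMap R R'))) (cartierDualMap j)).hom :=
    isMonHom_baseChangeIso_hom _ _
  haveI h2 : IsMonHom (kerIsoOfSq ((Over.pullback (Spec.map (CommRingCat.ofHom (algebraMap R R')))).map (cartierDualMap j))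
      (cartierDualMap ((Over.pullback (Spec.map (CommRingCat.ofHom (algebraMap R R')))).map j))
      (cartierDualBaseChangeIso R' G) (cartierDualBaseChangeIso R' H)
      (pullback_map_cartierDualMap_comp_cartierDualBaseChangeIso_hom R' j)).hom :=
    isMonHom_kerIsoOfSq_hom _ _ _ _ _
  change IsMonHom ((baseChangeIso (Spec.map (CommRingCat.ofHom (algebraMap R R'))) (cartierDualMap j)).hom ≫ (kerIsoOfSq _ _ _ _ _).hom)
  infer_instance

/-- The inverse `(H_{R′})^⊥ ≅ (H^⊥)_{R′}` is a homomorphism too (Mathlib: the inverse of an isomorphism of group objects).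
[cite: Tate1997FiniteFlatGroupSchemes, §(3.8) pp. 145–146] -/
theorem isMonHom_annihilatorBaseChangeIso_inv : IsMonHom (annihilatorBaseChangeIso R' j).inv := by
  haveI := isMonHom_annihilatorBaseChangeIso_hom R' j
  infer_instance

/-! ## §2 Points -/

/-- **A `T`-point `x` of `(G^D)_{R′}` factors through `(H^⊥)_{R′}` iff `x ≫ φ_G` factors through `(H_{R′})^⊥`** — i.e. (★ `exists_eq_comp_annihilatorι_iff`)
iff the character of `G_{R′}` it defines is trivial on `H_{R′}`. [cite: Tate1997FiniteFlatGroupSchemes, §(3.8) p. 146] -/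
theorem exists_eq_comp_pullback_map_annihilatorι_iff {T : SchemeOver R'}
    (x : T ⟶ (Over.pullback (Spec.map (CommRingCat.ofHom (algebraMap R R')))).obj (cartierDual G)) :
    (∃ k : T ⟶ (Over.pullback (Spec.map (CommRingCat.ofHom (algebraMap R R')))).obj (annihilator j),
        k ≫ (Over.pullback (Spec.map (CommRingCat.ofHom (algebraMap R R')))).map (annihilatorι j) = x) ↔
      ∃ k' : T ⟶ annihilator ((Over.pullback (Spec.map (CommRingCat.ofHom (algebraMap R R')))).map j),
        k' ≫ annihilatorι ((Over.pullback (Spec.map (CommRingCat.ofHom (algebraMap R R')))).map j) = x ≫ (cartierDualBaseChangeIso R' G).hom := by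
  constructor
  · rintro ⟨k, rfl⟩
    exact ⟨k ≫ (annihilatorBaseChangeIso R' j).hom, by rw [Category.assoc, annihilatorBaseChangeIso_hom_comp_annihilatorι, Category.assoc]⟩
  · rintro ⟨k', hk'⟩
    refine ⟨k' ≫ (annihilatorBaseChangeIso R' j).inv, ?_⟩
    rw [Category.assoc, annihilatorBaseChangeIso_inv_comp_pullback_map_annihilatorι, ← Category.assoc, hk', Category.assoc, Iso.hom_inv_id,
      Category.comp_id]

end AffineGroupScheme

end Literature.AlgebraicGeometry.GroupSchemes

end
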